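import Literature.Computability.AlgebraicComplexity.CKSV22PerturbationHeight
import Literature.Computability.AlgebraicComplexity.CKSV22EsymSingularLocusHeight
import Literature.Computability.AlgebraicComplexity.CKSV22UnlayeredABPRobustBound
import Mathlib.RingTheory.MvPolynomial.EulerIdentity
import HarnessLib

/-!
# CKSV 2022, Lemma 24 (robust singular locus of `ESYM`) and its consequences: Thm. 7 and Thm. 2 for `ESYM`, and the counting step of Thm. 31

P. Chatterjee, M. Kumar, A. She, B. L. Volk, *Quadratic lower bounds for algebraic branching programs
and formulas*, comput. complex. **31** (2022) 8 (arXiv:1911.11793), §5.1.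

**Lemma 24** (TeX L740–745, attributed to [MZ17, LMP19]): "Let `n, d ∈ ℕ` be natural numbers with
`d ≤ n` and let `𝔽` be a field of characteristic at least `d+1`, and let `R_1, …, R_n ∈ 𝔽[x]` be
polynomials of degree at most `d − 2`. Then, the dimension of the variety
`V = 𝕍({∂_{x_i} ESYM(n,d) − R_i : i ∈ [n]})` is at most `d − 2`." Printed proof (L789): Lemma 21
(the case `R_i = 0`) and Lemma 25 (lower-order perturbations do not raise the dimension).

## What is proved

* `CKSV2022.lemma_24_height` — **Lemma 24 in height form** under the corrected hypothesis of the
  tree's Claim 22 / Lemma 21 ("`1, …, n` non-zero in `K`", see `CKSV22EsymSingularLocus`): every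
  prime ideal of `K[x_1, …, x_n]` containing all `∂_i e_{n,d} − g_i`, `deg g_i ≤ d − 2`, has
  height `≥ n − (d − 2)` (`2 ≤ d ≤ n`). Proof as printed: `lemma_21_height` transferred along
  `lemma_25_height'` (the `∂_i e_d` are homogeneous of degree `d − 1 > deg g_i`).
* Consequences, now unconditional for `ESYM` (the general statements are
  `CKSV2022.thm_7_of_robustHeight`, `CKSV2022.thm_2_of_robustHeight`,
  `CKSV2022.le_two_mul_card_of_eq_sum_mul_add`, assembled in this tree along CKSV's proofs for
  `Σ x_iⁿ` and the §1.5 remark "the lower bound in Theorem 1.1 also holds for elementary symmetric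
  polynomials … an analog of Claim 9 or Lemma 24 is true"):
  - `CKSV2022.esymm_robust_counting` — the inequality of Thm. 31's proof (TeX L893–900) in full
    (robust) form: `e_{n,d} = Σ_{j∈ι} P_j Q_j + R`, `P_j(0) = Q_j(0) = 0`, `deg R < d` forces
    `n − (d−2) ≤ 2|ι|`;
  - `CKSV2022.chatterjeeKumarSheVolk2022_thm_7_esymm` — Thm. 7 for `ESYM(n,d)`: an ABP with `k`
    vertices, labels of degree `≤ Δ`, formal degree `≤ d`, computing `e_{n,d} + Σ_{j<r} A_jB_j + R`
    has `(⌊d/Δ⌋ − 1)·(n − (d−2)) ≤ 2k + 2(⌊d/Δ⌋ − 1)·r`;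
  - `CKSV2022.chatterjeeKumarSheVolk2022_thm_2_esymm` — Thm. 2 / Cor. 20 for `ESYM(n,d)` (the ABP
    remark of §1.5, explicit constants): unlayered ABPs with `m` edges and labels of degree `≤ Δ`
    computing `e_{n,d}` satisfy `(n − (d−2))·log₂ d ≤ 4m·(log₂ log₂ d + log₂ Δ + 4 + a)` whenever
    `16Δ log₂ d ≤ d` and `n − (d−2) ≤ 2^a·d`.

D-0026: no named facts, no definitions.

## References
* [ChatterjeeKumarSheVolk2022] — §5.1 Lemma 24, Lemma 25, Lemma 21; §1.5 (remark); Thm. 2, Thm. 7,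
  Thm. 31 (proof).
-/

noncomputable section

open MvPolynomial Finset

namespace Literature.Computability.AlgebraicComplexity

namespace CKSV2022

open Kumar2019

variable {K : Type*} [Field K]

/-- **CKSV 2022, Lemma 24, height form** (robust singular locus of `ESYM(n,d)`; corrected field
hypothesis "`1, …, n ≠ 0` in `K`"): for `2 ≤ d ≤ n` and `g_1, …, g_n` of degree `≤ d − 2`, every
prime ideal containing all `∂_i e_{n,d} − g_i` has height `≥ n − (d − 2)`. Proof as printed:
Lemma 21 (`lemma_21_height`) and Lemma 25 (`lemma_25_height'`).
[cite: ChatterjeeKumarSheVolk2022, Lemma 24] -/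
theorem lemma_24_height {n d : ℕ} (hd : 2 ≤ d) (hdn : d ≤ n)
    (hK : ∀ k : ℕ, 1 ≤ k → k ≤ n → (k : K) ≠ 0)
    (g : Fin n → MvPolynomial (Fin n) K) (hg : ∀ i, (g i).totalDegree ≤ d - 2)
    (P : Ideal (MvPolynomial (Fin n) K)) (hP : P.IsPrime)
    (hle : ∀ i, pderiv i (esymm (Fin n) K d) - g i ∈ P) :
    ((n - (d - 2) : ℕ) : ℕ∞) ≤ P.height := by
  classical
  refine lemma_25_height' (fun i => pderiv i (esymm (Fin n) K d)) (fun i => -g i) (fun _ => d - 1)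
    (fun i => (esymm_isHomogeneous (K := K) (σ := Fin n) d).pderiv) (fun i => ?_)
    (fun Q hQ hfQ => lemma_21_height (Fintype.card_fin n) hd hdn hK Q hfQ) P
    (fun i => by rw [← sub_eq_add_neg]; exact hle i)
  rw [totalDegree_neg]
  exact lt_of_le_of_lt (hg i) (by omega)

/-- **The counting step of CKSV Thm. 31, robust form** (TeX L893–900: "`V' ⊆ V`, `V' ≠ ∅`, by
Lemma 24 `dim V ≤ d − 2`, `dim V' ≥ n − 2k − 2r` … hence `n − 2k − 2r ≤ d − 2`"), general degree:
if `e_{n,d} = Σ_{j∈ι} P_j Q_j + R` with `P_j(0) = Q_j(0) = 0` and `deg R < d` (`2 ≤ d ≤ n`,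
`1, …, n ≠ 0` in `K`), then `n − (d−2) ≤ 2|ι|`. [cite: ChatterjeeKumarSheVolk2022, Theorem 31 (proof)] -/
theorem esymm_robust_counting {n d : ℕ} (hd : 2 ≤ d) (hdn : d ≤ n)
    (hK : ∀ k : ℕ, 1 ≤ k → k ≤ n → (k : K) ≠ 0) {ι : Type*} [Fintype ι]
    (P Q : ι → MvPolynomial (Fin n) K) (hP : ∀ j, constantCoeff (P j) = 0)
    (hQ : ∀ j, constantCoeff (Q j) = 0) (R : MvPolynomial (Fin n) K) (hR : R.totalDegree < d)
    (h : esymm (Fin n) K d = ∑ j, P j * Q j + R) : n - (d - 2) ≤ 2 * Fintype.card ι :=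
  le_two_mul_card_of_eq_sum_mul_add (lemma_24_height hd hdn hK) P Q hP hQ R hR h

/-- **CKSV 2022, Thm. 7 for `ESYM(n,d)`** (labels of degree `≤ Δ`, formal degree `≤ d`): an ABP
with `k` vertices computing `e_{n,d} + Σ_{j<r} A_j B_j + R` (`A_j(0) = B_j(0) = 0`, `deg R < d`)
has `(⌊d/Δ⌋ − 1)·(n − (d−2)) ≤ 2k + 2(⌊d/Δ⌋ − 1)·r` (`2 ≤ d ≤ n`, `1 ≤ Δ`, `1, …, n ≠ 0` in
`K`). Assembled in this tree: `thm_7_of_robustHeight` with Lemma 24.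
[cite: ChatterjeeKumarSheVolk2022, Theorem 7 and §1.5 (remark)] -/
theorem chatterjeeKumarSheVolk2022_thm_7_esymm {n d k r Δ : ℕ} (hd : 2 ≤ d) (hdn : d ≤ n)
    (hK : ∀ j : ℕ, 1 ≤ j → j ≤ n → (j : K) ≠ 0) (hΔ : 1 ≤ Δ)
    (A B : Fin r → MvPolynomial (Fin n) K)
    (hA0 : ∀ j, constantCoeff (A j) = 0) (hB0 : ∀ j, constantCoeff (B j) = 0)
    (R : MvPolynomial (Fin n) K) (hRd : R.totalDegree < d)
    (h : Kumar2019.ABPDegFormalDegreeComputes k Δ d (esymm (Fin n) K d + ∑ j, A j * B j + R)) :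
    (d / Δ - 1) * (n - (d - 2)) ≤ 2 * k + 2 * (d / Δ - 1) * r :=
  thm_7_of_robustHeight hΔ (lemma_24_height hd hdn hK) A B hA0 hB0 R hRd h

/-- `e_{n,d}` has no constant term for `d ≥ 1`. [cite: ChatterjeeKumarSheVolk2022, §5.1] -/
theorem constantCoeff_esymm {σ : Type*} [Fintype σ] [DecidableEq σ] {d : ℕ} (hd : d ≠ 0) :
    constantCoeff (esymm σ K d) = 0 := by
  have h := (esymm_isHomogeneous (K := K) (σ := σ) d).coeff_eq_zero (d := 0)
    (by rw [map_zero]; exact fun h => hd h.symm)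
  rw [constantCoeff_eq]
  exact h

/-- **CKSV 2022, Thm. 2 / Cor. 20 for `ESYM(n,d)`** — the ABP remark of §1.5 ("the lower bound in
Theorem 1.1 also holds for elementary symmetric polynomials"), explicit constants: for `2 ≤ d ≤ n`,
`1, …, n ≠ 0` in `K`, `1 ≤ Δ`, `16Δ·log₂ d ≤ d` and `n − (d−2) ≤ 2^a·d`, every unlayered ABP with
`m` edges and labels of degree `≤ Δ` computing `e_{n,d}` has
`(n − (d−2))·log₂ d ≤ 4m·(log₂ log₂ d + log₂ Δ + 4 + a)`. Assembled in this tree: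
`thm_2_of_robustHeight` with Lemma 24. [cite: ChatterjeeKumarSheVolk2022, §1.5 (remark), Theorem 2] -/
theorem chatterjeeKumarSheVolk2022_thm_2_esymm {n d a Δ τ m : ℕ} (hd : 2 ≤ d) (hdn : d ≤ n)
    (hK : ∀ j : ℕ, 1 ≤ j → j ≤ n → (j : K) ≠ 0) (hΔ : 1 ≤ Δ)
    (hbig : 16 * Δ * Nat.log 2 d ≤ d) (hcd : n - (d - 2) ≤ 2 ^ a * d)
    (h : UnlayeredABPComputes τ m Δ (esymm (Fin n) K d)) :
    (n - (d - 2)) * Nat.log 2 d ≤ 4 * m * (Nat.log 2 (Nat.log 2 d) + Nat.log 2 Δ + 4 + a) :=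
  thm_2_of_robustHeight (constantCoeff_esymm (by omega)) hd hΔ hbig hcd
    (lemma_24_height hd hdn hK) h

end CKSV2022

end Literature.Computability.AlgebraicComplexity

end
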